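import Summits.PneNP.PneNP.Theorems.SfmBlMachineTracePairs
import Summits.PneNP.PneNP.Theorems.SfmBlTraceExpansion

/-!
# Line «sfm-bl», MACHINE LAYER M3-SEM: the machine's `traceSum` IS the cylinder sum of the remainder traces (stmt-PneNP-20523)

FRONTIER F-N1c; nothing here bears on P vs NP.

The final identification of MACHINE-PLAN M3.  Generic dictionary setting: legs `e : Fin m × Fin 3` with pieces
`src e : α`, `dst e : β`, part labelling `p` (remainder = `none`), an injective record map `φ` with
`labL (φ e) = ι₁ (src e)`, `labR (φ e) = ι₂ (dst e)`, `(φ e).1 = e.1` (`ι₁`, `ι₂` injective), and the machine's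
remainder list `rl` (duplicate-free, `x ∈ rl ↔ ∃ e, p e = none ∧ φ e = x`).  Then for every prefix `(k ≤ m, T0)`,
every `q` and a non-binding cap:
**`traceSum_eq_sum_cylinder`** —
`(traceSum k T0 (2^(m−k+1)) rl cap u : ℝ) = Σ_{T : ∀ i < k, T i = T0[i]} tr((fromBlocks 0 (MR T) (MR T)ᵀ 0)^{2(q+1)})`,
`|u| = 2q + 1`, `MR T i k = Σ_{e : src e = i, dst e = k, p e = none} χ(T e.1)` — prover-1's `traceSum_eq_sum_pairs` +
`contrib_eq` + `count_outs_seqOf` on the machine side, p3's `sum_cylinder_trace_pow_eq_parts` + `prod_even_indicator` +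
`prod_boolSign_pow_eq_neg_one_pow` on the matrix side, and the reindexing `Fin |rl| ≃ {e // p e = none}` (`rlEquiv`).
-/

set_option linter.dupNamespace false -- `Summit.PneNP.PneNP.…`: summit = sub-problem name (D-0017 single-conjunct layout)

namespace Summit.PneNP.PneNP.Theorems.SfmBlMachine

open Finset Matrix
open Literature.Computability.Complexity (IsAdmissible)
open Summit.PneNP.PneNP.Theorems.SfmBl (sum_cylinder_trace_pow_eq_parts prod_even_indicator prod_boolSign_pow_eq_neg_one_pow)

section Sem

variable {α β : Type} [Fintype α] [Fintype β] [DecidableEq α] [DecidableEq β] {m r : ℕ}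
  {src : Fin m × Fin 3 → α} {dst : Fin m × Fin 3 → β} {p : Fin m × Fin 3 → Option (Fin r)}
  {ι₁ : α → Lab} {ι₂ : β → Lab} {φ : Fin m × Fin 3 → PLeg} {rl : List PLeg}

/-! ## The reindexing `Fin |rl| ≃ {e // p e = none}` -/

/-- The remainder leg sitting at position `a` of the machine's remainder list. -/
noncomputable def rlLeg (hmem : ∀ x, x ∈ rl ↔ ∃ e, p e = none ∧ φ e = x) (a : Fin rl.length) :
    {e : Fin m × Fin 3 // p e = none} :=
  ⟨Classical.choose ((hmem _).1 (List.getElem_mem a.isLt)), (Classical.choose_spec ((hmem _).1 (List.getElem_mem a.isLt))).1⟩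

/-- Its record is the list item. -/
theorem φ_rlLeg (hmem : ∀ x, x ∈ rl ↔ ∃ e, p e = none ∧ φ e = x) (a : Fin rl.length) :
    φ (rlLeg hmem a).1 = rl.get a :=
  (Classical.choose_spec ((hmem _).1 (List.getElem_mem a.isLt))).2

/-- `rlLeg` is a bijection (injective records, duplicate-free list). -/
theorem rlLeg_bijective (hφ : Function.Injective φ) (hrl : rl.Nodup) (hmem : ∀ x, x ∈ rl ↔ ∃ e, p e = none ∧ φ e = x) :
    Function.Bijective (rlLeg hmem) := by
  constructor
  · intro a b h
    have h1 := φ_rlLeg hmem a; have h2 := φ_rlLeg hmem b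
    rw [h] at h1
    exact (List.nodup_iff_injective_get.1 hrl) (h1.symm.trans h2)
  · rintro ⟨e, he⟩
    obtain ⟨a, ha⟩ := List.get_of_mem ((hmem _).2 ⟨e, he, rfl⟩)
    refine ⟨a, Subtype.ext (hφ ?_)⟩
    rw [φ_rlLeg hmem a, ha]

/-- The reindexing equivalence. -/
noncomputable def rlEquiv (hφ : Function.Injective φ) (hrl : rl.Nodup) (hmem : ∀ x, x ∈ rl ↔ ∃ e, p e = none ∧ φ e = x) :
    Fin rl.length ≃ {e : Fin m × Fin 3 // p e = none} :=
  Equiv.ofBijective (rlLeg hmem) (rlLeg_bijective hφ hrl hmem)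

/-! ## Bookkeeping on prefixes -/

/-- `#{i : Fin m | i < k} = k` for `k ≤ m`. -/
theorem card_filter_val_lt {k : ℕ} (hk : k ≤ m) : (univ.filter fun i : Fin m => (i : ℕ) < k).card = k := by
  have h : (univ.filter fun i : Fin m => (i : ℕ) < k).card = (Finset.range k).card := by
    refine Finset.card_bij (fun i _ => i.val) (fun i hi => ?_) (fun i _ j _ h => Fin.ext h) (fun v hv => ?_)
    · rw [mem_filter] at hi; exact mem_range.2 hi.2
    · rw [mem_range] at hv; exact ⟨⟨v, lt_of_lt_of_le hv hk⟩, mem_filter.2 ⟨mem_univ _, hv⟩, rfl⟩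
  rw [h, Finset.card_range]

/-- `#{i : Fin m | ¬ i < k} = m − k` for `k ≤ m`. -/
theorem card_compl_filter_val_lt {k : ℕ} (hk : k ≤ m) : (univ.filter fun i : Fin m => (i : ℕ) < k)ᶜ.card = m - k := by
  rw [Finset.card_compl, card_filter_val_lt hk, Fintype.card_fin]

/-- A sum over the `true` prefix positions, `ℕ`-indexed vs `Fin m`-indexed. -/
theorem sum_range_filter_eq_sum_fin {k : ℕ} (hk : k ≤ m) (T0 : List Bool) (μ : ℕ → ℕ) :
    ∑ i ∈ (Finset.range k).filter (fun i => T0.getD i false = true), μ i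
      = ∑ i ∈ (univ.filter fun i : Fin m => (i : ℕ) < k).filter (fun i => T0.getD i.val false = true), μ i.val := by
  symm
  refine Finset.sum_bij (fun i _ => i.val) (fun i hi => ?_) (fun i _ j _ h => Fin.ext h) (fun v hv => ?_) (fun _ _ => rfl)
  · simp only [mem_filter, mem_univ, true_and] at hi
    exact mem_filter.2 ⟨mem_range.2 hi.1, hi.2⟩
  · simp only [mem_filter, mem_range] at hv
    exact ⟨⟨v, lt_of_lt_of_le hv.1 hk⟩, by simp only [mem_filter, mem_univ, true_and]; exact hv, rfl⟩

/-! ## The termwise identity -/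

/-- Multiplicity of an output among the legs of a pair of leg functions, `ℕ`-indexed. -/
theorem mu_nat_eq {q : ℕ} (L L' : Fin (q + 1) → Fin m × Fin 3) (i : Fin m) :
    (univ.filter fun j => (L j).1.val = i.val).card + (univ.filter fun j => (L' j).1.val = i.val).card
      = (univ.filter fun j => (L j).1 = i).card + (univ.filter fun j => (L' j).1 = i).card := by
  congr 1 <;> exact congrArg _ (filter_congr fun j _ => Fin.val_inj)

/-- Outputs `≥ m` do not occur. -/
theorem mu_nat_eq_zero {q : ℕ} (L L' : Fin (q + 1) → Fin m × Fin 3) {i : ℕ} (hi : m ≤ i) :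
    (univ.filter fun j => (L j).1.val = i).card + (univ.filter fun j => (L' j).1.val = i).card = 0 := by
  rw [Finset.card_eq_zero.2 (Finset.filter_eq_empty_iff.2 fun j _ h => absurd ((L j).1.isLt) (by omega)),
    Finset.card_eq_zero.2 (Finset.filter_eq_empty_iff.2 fun j _ h => absurd ((L' j).1.isLt) (by omega))]

/-- THE TERM OF ONE PAIR: the machine's contribution (through the reindexed records) is p3's cylinder term times `2`,
with `pw = 2^{m−k+1}`. -/
theorem contrib_seqOf_eq (hO : ∀ e, (φ e).1 = e.1.val)
    {k : ℕ} (hk : k ≤ m) (T0 : List Bool) {q : ℕ} (L L' : Fin (q + 1) → Fin m × Fin 3) :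
    ((contrib k T0 (2 ^ (m - k + 1)) (seqOf (fun j => φ (L j)) (fun j => φ (L' j))) : ℤ) : ℝ)
      = 2 * ((∏ i ∈ univ.filter (fun i : Fin m => (i : ℕ) < k),
              (((CandCutNorm.boolSign (T0.getD i.val false) : ℤ) : ℝ)) ^
                ((univ.filter (fun j => (L j).1 = i)).card + (univ.filter (fun j => (L' j).1 = i)).card))
            * ∏ i ∈ (univ.filter fun i : Fin m => (i : ℕ) < k)ᶜ,
              (if Even ((univ.filter (fun j => (L j).1 = i)).card + (univ.filter (fun j => (L' j).1 = i)).card)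
                then (2 : ℝ) else 0)) := by
  classical
  set P := univ.filter fun i : Fin m => (i : ℕ) < k with hP
  set μ : Fin m → ℕ := fun i => (univ.filter (fun j => (L j).1 = i)).card + (univ.filter (fun j => (L' j).1 = i)).card with hμ
  -- the multiplicities read by the machine
  have hcount : ∀ i : ℕ, (outs (seqOf (fun j => φ (L j)) (fun j => φ (L' j)))).count i
      = (univ.filter fun j => (L j).1.val = i).card + (univ.filter fun j => (L' j).1.val = i).card := by
    intro i
    rw [count_outs_seqOf]
    congr 1 <;> exact congrArg _ (filter_congr fun j _ => by rw [hO])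
  rw [contrib_eq, prod_boolSign_pow_eq_neg_one_pow, prod_even_indicator, card_compl_filter_val_lt hk]
  -- the parity condition
  have hcond : (∀ i, k ≤ i → (outs (seqOf (fun j => φ (L j)) (fun j => φ (L' j)))).count i % 2 = 0)
      ↔ ∀ i ∈ Pᶜ, Even (μ i) := by
    constructor
    · intro h i hi
      rw [hP, mem_compl, mem_filter, not_and] at hi
      have := h i.val (not_lt.1 (hi (mem_univ _)))
      rw [hcount, mu_nat_eq] at this
      exact Nat.even_iff.2 this
    · intro h i hki
      rw [hcount]
      by_cases him : i < m
      · have := h ⟨i, him⟩ (by rw [hP, mem_compl, mem_filter]; exact fun h' => absurd h'.2 (not_lt.2 hki))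
        have hfin : (univ.filter fun j => (L j).1.val = i).card + (univ.filter fun j => (L' j).1.val = i).card
            = μ ⟨i, him⟩ := mu_nat_eq L L' ⟨i, him⟩
        rw [hfin]
        exact Nat.even_iff.1 this
      · rw [mu_nat_eq_zero L L' (not_lt.1 him)]
  by_cases hc : ∀ i ∈ Pᶜ, Even (μ i)
  · rw [if_pos (hcond.2 hc), if_pos hc]
    -- the sign exponent
    have hexp : ∑ i ∈ (Finset.range k).filter (fun i => T0.getD i false = true),
        (outs (seqOf (fun j => φ (L j)) (fun j => φ (L' j)))).count i
        = ∑ i ∈ P.filter (fun i => T0.getD i.val false = true), μ i := by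
      rw [Finset.sum_congr rfl (fun i _ => hcount i), sum_range_filter_eq_sum_fin hk]
      exact Finset.sum_congr rfl fun i _ => mu_nat_eq L L' i
    rw [hexp]
    push_cast
    ring
  · rw [if_neg (fun h => hc (hcond.1 h)), if_neg hc]
    push_cast
    ring

/-! ## The sum identity -/

/-- Sums over leg functions constrained to the remainder are sums over functions into the remainder subtype. -/
theorem sum_ite_forall_none_eq {M : Type} [AddCommMonoid M] {q : ℕ}
    (g : (Fin (q + 1) → Fin m × Fin 3) → M) :
    ∑ L : Fin (q + 1) → Fin m × Fin 3, (if ∀ j, p (L j) = none then g L else 0)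
      = ∑ L : Fin (q + 1) → {e : Fin m × Fin 3 // p e = none}, g (fun j => (L j).val) := by
  classical
  rw [← Finset.sum_filter,
    Finset.sum_subtype (univ.filter fun L : Fin (q + 1) → Fin m × Fin 3 => ∀ j, p (L j) = none)
      (p := fun L : Fin (q + 1) → Fin m × Fin 3 => ∀ j, p (L j) = none) (fun L => by simp) g]
  exact Fintype.sum_equiv
    (Equiv.subtypePiEquivPi (α := Fin (q + 1)) (β := fun _ => Fin m × Fin 3) (p := fun _ e => p e = none))
    _ _ (fun L => rfl)

/-- **M3-SEM: THE MACHINE'S TRACE SUM IS THE CYLINDER SUM OF THE REMAINDER TRACES.** -/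
theorem traceSum_eq_sum_cylinder (hφ : Function.Injective φ) (hrl : rl.Nodup)
    (hmem : ∀ x, x ∈ rl ↔ ∃ e, p e = none ∧ φ e = x)
    (hL : ∀ e, labL (φ e) = ι₁ (src e)) (hR : ∀ e, labR (φ e) = ι₂ (dst e)) (hO : ∀ e, (φ e).1 = e.1.val)
    (hι₁ : Function.Injective ι₁) (hι₂ : Function.Injective ι₂)
    (MR : (Fin m → Bool) → Matrix α β ℝ)
    (hMR : ∀ T i k, MR T i k = ∑ e ∈ univ.filter
      (fun e : Fin m × Fin 3 => src e = i ∧ dst e = k ∧ p e = none), ((CandCutNorm.boolSign (T e.1) : ℤ) : ℝ))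
    {k : ℕ} (hk : k ≤ m) (T0 : List Bool) (q cap : ℕ) (u : List Unit) (hu : u.length = 2 * q + 1)
    (hcap : ∀ k', k' ≤ u.length → (aseqsU rl k').length ≤ cap) :
    ((traceSum k T0 (2 ^ (m - k + 1)) rl cap u : ℤ) : ℝ)
      = ∑ T ∈ (univ : Finset (Fin m → Bool)).filter
            (fun T => ∀ i ∈ univ.filter (fun i : Fin m => (i : ℕ) < k), T i = T0.getD i.val false),
          ((Matrix.fromBlocks 0 (MR T) (MR T)ᵀ 0) ^ (2 * (q + 1))).trace := by
  classical
  rw [sum_cylinder_trace_pow_eq_parts src dst p MR hMR q (univ.filter fun i : Fin m => (i : ℕ) < k)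
    (fun i => T0.getD i.val false), traceSum_eq_sum_pairs hrl q cap u hu hcap k T0 _]
  push_cast
  set eR := rlEquiv hφ hrl hmem with heR
  have hget : ∀ a : Fin rl.length, rl.get a = φ (eR a).val := fun a => (φ_rlLeg hmem a).symm
  -- machine side: reindex both index functions along `eR`
  rw [Fintype.sum_equiv (Equiv.arrowCongr (Equiv.refl _) eR) _
    (fun L : Fin (q + 1) → {e : Fin m × Fin 3 // p e = none} => ∑ L' : Fin (q + 1) → {e : Fin m × Fin 3 // p e = none},
      if IsAdmissible src dst (fun j => (L j).val) (fun j => (L' j).val) then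
        ((contrib k T0 (2 ^ (m - k + 1)) (seqOf (fun j => φ (L j).val) (fun j => φ (L' j).val)) : ℤ) : ℝ) else 0)
    (fun A => ?_)]
  · -- matrix side: restrict to the remainder and compare termwise
    rw [Finset.mul_sum]
    have inner : ∀ L : Fin (q + 1) → Fin m × Fin 3,
        2 * ∑ L' : Fin (q + 1) → Fin m × Fin 3,
          (if IsAdmissible src dst L L' ∧ (∀ j, p (L j) = none ∧ p (L' j) = none) then
            (∏ i ∈ univ.filter (fun i : Fin m => (i : ℕ) < k), (((CandCutNorm.boolSign (T0.getD i.val false) : ℤ) : ℝ)) ^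
                ((univ.filter (fun j => (L j).1 = i)).card + (univ.filter (fun j => (L' j).1 = i)).card))
              * ∏ i ∈ (univ.filter fun i : Fin m => (i : ℕ) < k)ᶜ,
                (if Even ((univ.filter (fun j => (L j).1 = i)).card + (univ.filter (fun j => (L' j).1 = i)).card)
                  then (2 : ℝ) else 0)
          else 0)
        = if ∀ j, p (L j) = none then
            ∑ L' : Fin (q + 1) → {e : Fin m × Fin 3 // p e = none},
              (if IsAdmissible src dst L (fun j => (L' j).val) then
                ((contrib k T0 (2 ^ (m - k + 1)) (seqOf (fun j => φ (L j)) (fun j => φ (L' j).val)) : ℤ) : ℝ) else 0)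
          else 0 := by
      intro L
      by_cases hLn : ∀ j, p (L j) = none
      · rw [if_pos hLn, Finset.mul_sum, ← sum_ite_forall_none_eq (p := p)
          (fun L' => if IsAdmissible src dst L L' then
            ((contrib k T0 (2 ^ (m - k + 1)) (seqOf (fun j => φ (L j)) (fun j => φ (L' j))) : ℤ) : ℝ) else 0)]
        refine Finset.sum_congr rfl fun L' _ => ?_
        by_cases hL'n : ∀ j, p (L' j) = none
        · rw [if_pos hL'n]
          by_cases hadm : IsAdmissible src dst L L'
          · rw [if_pos ⟨hadm, fun j => ⟨hLn j, hL'n j⟩⟩, if_pos hadm, contrib_seqOf_eq hO hk T0 L L']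
          · rw [if_neg (fun h => hadm h.1), if_neg hadm, mul_zero]
        · rw [if_neg hL'n, if_neg (fun h => hL'n fun j => (h.2 j).2), mul_zero]
      · rw [if_neg hLn]
        rw [Finset.sum_eq_zero fun L' _ => ?_, mul_zero]
        exact if_neg (fun h => hLn fun j => (h.2 j).1)
    rw [Finset.sum_congr rfl (fun L _ => inner L), sum_ite_forall_none_eq (p := p)]
  · -- the reindexed machine term
    refine Finset.sum_equiv (Equiv.arrowCongr (Equiv.refl _) eR) (fun _ => by simp) (fun A' _ => ?_)
    simp only [Equiv.arrowCongr_apply, Function.comp_apply, Equiv.refl_symm, Equiv.coe_refl, id_eq]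
    have hA : ∀ j, rl.get (A j) = φ (eR (A j)).val := fun j => hget (A j)
    have hA' : ∀ j, rl.get (A' j) = φ (eR (A' j)).val := fun j => hget (A' j)
    have hadm : IsAdmissible (fun a => labL (rl.get a)) (fun a => labR (rl.get a)) A A'
        ↔ IsAdmissible src dst (fun j => (eR (A j)).val) (fun j => (eR (A' j)).val) := by
      unfold IsAdmissible
      simp only [hA, hA', hL, hR, hι₁.eq_iff, hι₂.eq_iff]
    have hseq : seqOf (fun j => rl.get (A j)) (fun j => rl.get (A' j))
        = seqOf (fun j => φ (eR (A j)).val) (fun j => φ (eR (A' j)).val) := by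
      congr 1 <;> funext j
      · exact hA j
      · exact hA' j
    rw [hseq]
    by_cases h : IsAdmissible src dst (fun j => (eR (A j)).val) (fun j => (eR (A' j)).val)
    · rw [if_pos (hadm.2 h), if_pos h]
    · rw [if_neg (fun h' => h (hadm.1 h')), if_neg h]

end Sem

end Summit.PneNP.PneNP.Theorems.SfmBlMachine
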